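import Literature.LinearAlgebra.Matrix.PermanentBooleanSum
import HarnessLib

/-!
# Subpermanents: column expansion, exact Laplace splitting, ranked-diagonal evaluation

A third small permanent toolkit (companion of `PermanentLaplace.lean` and `PermanentSubperm.lean`),
written for the read-once permanent gadget of `Literature/Computability/AlgebraicComplexity/
ReadOncePermanentTree.lean` (Hrubeš–Joglekar 2025, Thm. 3 / Thm. 7). Everything is phrased for
`Matrix.subperm M p q` (BCS 1997, (21.30): the sum over the bijections from the `p`-columns to the
`q`-rows of `∏ M (f i) i`), so that iterated expansions stay inside one ambient index type.

* `Matrix.subperm_expand_col_support`, `Matrix.subperm_col_two`: expansion along one column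
  supported in a set of rows / in at most two rows (column versions of
  `subperm_expand_row_support`, `subperm_row_two`; `subperm_transpose`, `subperm_expand_col`,
  `subperm_col_one` are in `Literature/LinearAlgebra/Matrix/PermanentBooleanSum.lean`).
* `Matrix.subperm_laplace_exact`: the single-term case `|F| = |B|` of the Laplace expansion with
  supports (`subperm_laplace_support`): if the columns `F` are supported inside the rows `B` and
  `|F| = |B|`, then `subperm p q = subperm F B · subperm (p ∖ F) (q ∖ B)` (block triangularity
  inside an ambient matrix).
* `Matrix.subperm_self_eq_prod_of_rank`, `Matrix.subperm_self_eq_one_of_rank`: if every non-zero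
  entry `M j i` inside the block either is diagonal or strictly increases a rank function
  (`rk i < rk j`), then only the identity bijection contributes: `subperm p p = ∏ M i i`
  (the permanent analogue of "triangular ⇒ product of the diagonal").

## Design notes

* Deliberate dot-notation extensions of Mathlib's `Matrix` namespace, like the companions;
  Mathlib has no subpermanents (searched `subperm`, `permanent_`: only `Matrix.permanent` with
  `permanent_transpose`, `permanent_permute_rows/cols`); the tree's `subperm` calculus lives in
  `PermanentSubperm.lean` and `LinearAlgebra/Matrix/PermanentBooleanSum.lean` (imported).
* Everything holds over a commutative semiring.

## References

* P. Bürgisser, M. Clausen, M. A. Shokrollahi, *Algebraic Complexity Theory*, Grundlehren 315,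
  Springer 1997, (21.30) (Laplace Expansion Theorem for permanents), pp. 560–561.
* H. Minc, *Permanents*, Encyclopedia Math. Appl. 6, Addison-Wesley 1978, §1.2. (Not held.)
-/

namespace Matrix

open Equiv Finset

variable {ι : Type*} [Fintype ι] [DecidableEq ι] {R : Type*} [CommSemiring R] (M : Matrix ι ι R)

/-- Expansion of a subpermanent along a column `i₀` supported in a set `T` of rows. [cite: BurgisserClausenShokrollahi1997, (21.30)] -/
theorem subperm_expand_col_support {p q : ι → Prop} [DecidablePred p] [DecidablePred q] (i₀ : ι)
    (hi₀ : p i₀) (T : Finset ι) (hT : ∀ j, q j → j ∉ T → M j i₀ = 0) :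
    M.subperm p q = ∑ j ∈ T.filter q,
      M j i₀ * M.subperm (fun i => p i ∧ i ≠ i₀) (fun j' => q j' ∧ j' ≠ j) := by
  rw [M.subperm_expand_col i₀ hi₀]
  symm
  refine Finset.sum_subset (fun j hj => ?_) (fun j hj hj' => ?_)
  · exact Finset.mem_filter.2 ⟨Finset.mem_univ _, (Finset.mem_filter.1 hj).2⟩
  · have hqj : q j := (Finset.mem_filter.1 hj).2
    rw [hT j hqj (fun h => hj' (Finset.mem_filter.2 ⟨h, hqj⟩)), zero_mul]

/-- Expansion along a column with at most two nonzero admissible entries (column version of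
`Matrix.subperm_row_two`). [folklore] -/
theorem subperm_col_two {p q : ι → Prop} [DecidablePred p] [DecidablePred q] (c r₁ r₂ : ι)
    (hc : p c) (hr₁ : q r₁) (hr₂ : q r₂) (hne : r₁ ≠ r₂)
    (hzero : ∀ r, q r → r ≠ r₁ → r ≠ r₂ → M r c = 0) :
    M.subperm p q = M r₁ c * M.subperm (fun i => p i ∧ i ≠ c) (fun j => q j ∧ j ≠ r₁) +
      M r₂ c * M.subperm (fun i => p i ∧ i ≠ c) (fun j => q j ∧ j ≠ r₂) := by
  rw [M.subperm_expand_col c hc]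
  refine Finset.sum_eq_add_of_mem r₁ r₂ (by simpa using hr₁) (by simpa using hr₂) hne ?_
  intro r hr hr'
  rw [hzero r (by simpa using hr) hr'.1 hr'.2, zero_mul]

/-- **Exact Laplace splitting** (the single-term case of BCS 1997, (21.30)): if the columns in `F`
vanish on the `q`-rows outside `B` and `|F| = |B|`, then the expansion along the rows `B` has
the single term `S = F`: `subperm p q = subperm F B · subperm (p ∖ F) (q ∖ B)`.
[cite: BurgisserClausenShokrollahi1997, (21.30)] -/
theorem subperm_laplace_exact {p q : ι → Prop} [DecidablePred p] [DecidablePred q]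
    (B : Finset ι) (hB : ∀ j ∈ B, q j) (F : Finset ι) (hFp : ∀ i ∈ F, p i)
    (hF : ∀ i ∈ F, ∀ j, q j → j ∉ B → M j i = 0) (hcard : F.card = B.card) :
    M.subperm p q = M.subperm (· ∈ F) (· ∈ B) *
      M.subperm (fun i => p i ∧ i ∉ F) (fun j => q j ∧ j ∉ B) := by
  rw [M.subperm_laplace_support B hB univ (fun _ _ i _ hi => absurd (Finset.mem_univ i) hi) F hFp hF]
  have hsingle : (((univ.filter p).powersetCard B.card).filter fun S => F ⊆ S) = {F} := by
    ext S
    simp only [Finset.mem_filter, Finset.mem_powersetCard, Finset.mem_singleton]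
    constructor
    · rintro ⟨⟨-, hS⟩, hFS⟩
      exact (Finset.eq_of_subset_of_card_le hFS (by rw [hS, hcard])).symm
    · rintro rfl
      exact ⟨⟨fun i hi => Finset.mem_filter.2 ⟨Finset.mem_univ _, hFp i hi⟩, hcard⟩,
        Finset.Subset.refl _⟩
  rw [hsingle, Finset.sum_singleton]

/-- **Ranked-diagonal evaluation**: if every non-zero entry `M j i` with `p i`, `p j` is diagonal
or strictly increases the rank (`rk i < rk j`), then the only bijection of the `p`-block with a
non-zero product is the identity, and `subperm p p = ∏_{p i} M i i` (permanent analogue of the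
determinant of a triangular matrix). [folklore] -/
theorem subperm_self_eq_prod_of_rank {p : ι → Prop} [DecidablePred p] (rk : ι → ℕ)
    (h : ∀ i j, p i → p j → M j i ≠ 0 → j = i ∨ rk i < rk j) :
    M.subperm p p = ∏ i ∈ univ.filter p, M i i := by
  unfold subperm
  rw [Finset.sum_eq_single (Equiv.refl _)]
  · -- the identity term
    simp only [Equiv.refl_apply]
    rw [← Finset.prod_subtype (univ.filter p) (p := p) (fun i => by simp) (fun i => M i i)]
  · -- every other bijection has a vanishing factor
    intro f _ hf
    by_contra hne
    have hne' : ∀ i : {i // p i}, M (f i) i ≠ 0 := fun i h0 =>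
      hne (Finset.prod_eq_zero (Finset.mem_univ i) h0)
    have hstep : ∀ i : {i // p i}, ((f i : ι) = i) ∨ rk i < rk (f i) := fun i =>
      h i (f i) i.2 (f i).2 (hne' i)
    have hle : ∀ i : {i // p i}, rk i ≤ rk (f i) := fun i => by
      rcases hstep i with h | h
      · rw [h]
      · exact h.le
    have hsum : ∑ i : {i // p i}, rk (f i) = ∑ i : {i // p i}, rk (i : ι) :=
      Equiv.sum_comp f (fun i : {i // p i} => rk (i : ι))
    have heq : ∀ i ∈ (univ : Finset {i // p i}), rk (i : ι) = rk (f i) :=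
      (Finset.sum_eq_sum_iff_of_le (fun i _ => hle i)).1 hsum.symm
    apply hf
    ext i
    rcases hstep i with h | h
    · exact h
    · exact absurd (heq i (Finset.mem_univ _)) h.ne
  · intro h; exact absurd (Finset.mem_univ _) h

/-- If moreover the diagonal entries of the block are `1`, the block subpermanent is `1`. [folklore] -/
theorem subperm_self_eq_one_of_rank {p : ι → Prop} [DecidablePred p] (rk : ι → ℕ)
    (h : ∀ i j, p i → p j → M j i ≠ 0 → j = i ∨ rk i < rk j) (hdiag : ∀ i, p i → M i i = 1) :
    M.subperm p p = 1 := by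
  rw [M.subperm_self_eq_prod_of_rank rk h]
  exact Finset.prod_eq_one fun i hi => hdiag i (Finset.mem_filter.1 hi).2

end Matrix
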